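import Mathlib
import Literature.MathematicalPhysics.QuantumLattice.Imbrie2016.UmbilicPlanes

/-!
# The `B_F(1,3)` chart of the three-spin block: two free ends, first- and second-order tables

Finite algebraic facts at the umbilic stratum `B_F(1,3)` (`h₂ = cos θ`, `t₂ = sin θ`, all other
parameters `0`: both END spins free) of the three-spin block,
[cite: ImbrieJSP2016, eq. (1.1), assumption LLA(ν, C)]  Repair cell b2b-imbrie, LLA.md blocks
P12–P14 (the second-order `Ω`-mechanism: ends coupled through the middle spin), Q7(d) (local law
at `B_F(1,3)`), refereed in REFEREE.md G263–G267.
J. Z. Imbrie, *On many-body localization for quantum spin chains*,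
J. Stat. Phys. 163 (2016) 998–1048, arXiv:1403.7837 (Theorem 1.1, Assumption LLA).

With UNCONSTRAINED half-angle parameters `p, q` put `N = p² + q²`, so that
`H₀ = (p² − q²) Z₂ + 2pq X₂ = N(cos θ Z₂ + sin θ X₂)` has middle-spin eigenvectors `u⁺ = (p, q)`
(eigenvalue `+N`) and `u⁻ = (−q, p)` (eigenvalue `−N`), exactly and without normalisation.  The
lower cluster is `T = ℂ²₁ ⊗ u⁻ ⊗ ℂ²₃` with frame `f i k = e_i ⊗ u⁻ ⊗ e_k` (`frame_gram`,
`cluster_kernel`: `(H₀ + N) f = 0`).  FIRST ORDER (`compress_ends`, `compress_middle`):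
`Z₁ ↦ Z⊗1`, `X₁ ↦ X⊗1`, `Z₃ ↦ 1⊗Z`, `X₃ ↦ 1⊗X` (the four swept directions `h₁, t₁, h₃, t₃`:
two free qubits), `Z₂ ↦ (q² − p²)·1`, `X₂ ↦ −2pq·1`, `Z₁Z₂ ↦ (q² − p²)·Z⊗1`, `Z₂Z₃ ↦ (q² − p²)·1⊗Z`
(all one-body: NO two-body coupling of the ends at first order).  SECOND ORDER (`second_order`):
for `V = a Z₂ + d X₂ + J₁ Z₁Z₂ + J₂ Z₂Z₃` the exact Gram identity
`⟨f_{ik}, V (H₀ + N) V f_{jl}⟩ = 2 δ_{ij} δ_{kl} W(j,l)²`,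
`W(j,l) = (p² − q²) d − 2pq (a + J₁σ₁(j) + J₂σ₃(l)) = ⟨u⁺| V |u⁻⟩`, holds; since `(H₀ + N)` is
`2N` on `T^⊥ = ℂ² ⊗ u⁺ ⊗ ℂ²` and `0` on `T`, the second-order effective operator
`−P_T V (H₀ + N)|_{T^⊥}⁻¹ V P_T` is `−W²/(2N³)·` (frame-normalised), whose `Z₁⊗Z₃` coefficient is
`−(2pq)² J₁J₂/N³ = −sin²θ·J₁J₂` at `N = 1`: the second-order `Ω`-coupling `κ = sin²θ·c₁₂J₂` of
LLA.md P12/P14/Q7(d) (`c₁₂ = J₁`).  Kets and operators as in `UmbilicPlanes`; polynomial algebra.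
-/

namespace Literature.MathematicalPhysics.QuantumLattice.Imbrie2016.ChartBF13

open UmbilicPlanes (Ket sgn transverse diag)

/-- [cite: ImbrieJSP2016, eq. (1.1)] `u⁻ = (−q, p)`, the lower middle-spin state. -/
def uM (p q : ℝ) (b : Fin 2) : ℝ := if b = 0 then -q else p

/-- [cite: ImbrieJSP2016, eq. (1.1)] `u⁺ = (p, q)`, the upper middle-spin state. -/
def uP (p q : ℝ) (b : Fin 2) : ℝ := if b = 0 then p else q

/-- [cite: ImbrieJSP2016, eq. (1.1)] The cluster frame `f i k = e_i ⊗ u⁻ ⊗ e_k` (two free ends). -/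
def frame (p q : ℝ) (i k : Fin 2) : Ket :=
  fun a b c => (if a = i then 1 else 0) * uM p q b * (if c = k then 1 else 0)

/-- [cite: ImbrieJSP2016, eq. (1.1)] The complementary frame `g i k = e_i ⊗ u⁺ ⊗ e_k`. -/
def cframe (p q : ℝ) (i k : Fin 2) : Ket :=
  fun a b c => (if a = i then 1 else 0) * uP p q b * (if c = k then 1 else 0)

/-- [cite: ImbrieJSP2016, eq. (1.1)] `H₀ + N = (p² − q²) Z₂ + 2pq X₂ + (p² + q²)`. -/
def H0N (p q : ℝ) (ψ : Ket) : Ket :=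
  fun a b c => diag (p ^ 2 + q ^ 2) 0 (p ^ 2 - q ^ 2) 0 0 0 ψ a b c + transverse 0 (2 * p * q) 0 ψ a b c

/-- [cite: ImbrieJSP2016, eq. (1.1)] The middle-spin directions `V = a Z₂ + d X₂ + J₁ Z₁Z₂ + J₂ Z₂Z₃`. -/
def V (a d J₁ J₂ : ℝ) (ψ : Ket) : Ket :=
  fun x b c => diag 0 0 a 0 J₁ J₂ ψ x b c + transverse 0 d 0 ψ x b c

/-- [cite: ImbrieJSP2016, eq. (1.1)] Gram relations: `f`, `g` orthogonal families, squared norms `N`. -/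
theorem frame_gram (p q : ℝ) (i j k l : Fin 2) :
    UmbilicPlanes.inner (frame p q i k) (frame p q j l) = (if i = j ∧ k = l then p ^ 2 + q ^ 2 else 0) ∧
    UmbilicPlanes.inner (cframe p q i k) (cframe p q j l) = (if i = j ∧ k = l then p ^ 2 + q ^ 2 else 0) ∧
    UmbilicPlanes.inner (frame p q i k) (cframe p q j l) = 0 := by
  refine ⟨?_, ?_, ?_⟩ <;> fin_cases i <;> fin_cases j <;> fin_cases k <;> fin_cases l <;>
    norm_num [UmbilicPlanes.inner, frame, cframe, uM, uP, Fin.sum_univ_two] <;> ring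

/-- [cite: ImbrieJSP2016, eq. (1.1)] `(H₀ + N) f = 0` and `(H₀ + N) g = 2N g`, exactly. -/
theorem cluster_kernel (p q : ℝ) (i k : Fin 2) :
    H0N p q (frame p q i k) = (fun _ _ _ => (0 : ℝ)) ∧
    H0N p q (cframe p q i k) = fun a b c => 2 * (p ^ 2 + q ^ 2) * cframe p q i k a b c := by
  refine ⟨?_, ?_⟩ <;> funext a b c <;> fin_cases i <;> fin_cases k <;> fin_cases a <;> fin_cases b <;>
    fin_cases c <;> norm_num [H0N, diag, UmbilicPlanes.landscape, transverse, frame, cframe, uM, uP,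
      sgn, Fin.rev] <;> ring

/-- [cite: ImbrieJSP2016, eq. (1.1)] FIRST ORDER, the two free ends: `Z₁ ↦ Z⊗1`, `X₁ ↦ X⊗1`,
`Z₃ ↦ 1⊗Z`, `X₃ ↦ 1⊗X` (Gram factor `N`). -/
theorem compress_ends (p q : ℝ) (i j k l : Fin 2) :
    UmbilicPlanes.inner (frame p q i k) (diag 0 1 0 0 0 0 (frame p q j l))
        = (if i = j ∧ k = l then (p ^ 2 + q ^ 2) * sgn i else 0) ∧
    UmbilicPlanes.inner (frame p q i k) (transverse 1 0 0 (frame p q j l))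
        = (if i ≠ j ∧ k = l then p ^ 2 + q ^ 2 else 0) ∧
    UmbilicPlanes.inner (frame p q i k) (diag 0 0 0 1 0 0 (frame p q j l))
        = (if i = j ∧ k = l then (p ^ 2 + q ^ 2) * sgn k else 0) ∧
    UmbilicPlanes.inner (frame p q i k) (transverse 0 0 1 (frame p q j l))
        = (if i = j ∧ k ≠ l then p ^ 2 + q ^ 2 else 0) := by
  refine ⟨?_, ?_, ?_, ?_⟩ <;> fin_cases i <;> fin_cases j <;> fin_cases k <;> fin_cases l <;>
    norm_num [UmbilicPlanes.inner, diag, UmbilicPlanes.landscape, transverse, frame, uM, sgn,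
      Fin.sum_univ_two, Fin.rev] <;> ring

/-- [cite: ImbrieJSP2016, eq. (1.1)] FIRST ORDER, middle-spin directions are ONE-BODY on `T`:
`⟨f_{ik}, V f_{jl}⟩ = δδ·((q² − p²)(a + J₁σ₁(j) + J₂σ₃(l)) − 2pq·d)`; in particular `Z₁Z₂ ↦ (q²−p²) Z⊗1`,
`Z₂Z₃ ↦ (q²−p²) 1⊗Z` and there is NO `Z⊗Z` coupling of the ends at first order. -/
theorem compress_middle (p q a d J₁ J₂ : ℝ) (i j k l : Fin 2) :
    UmbilicPlanes.inner (frame p q i k) (V a d J₁ J₂ (frame p q j l))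
      = if i = j ∧ k = l then (q ^ 2 - p ^ 2) * (a + J₁ * sgn j + J₂ * sgn l) - 2 * p * q * d
        else 0 := by
  fin_cases i <;> fin_cases j <;> fin_cases k <;> fin_cases l <;>
    norm_num [UmbilicPlanes.inner, V, diag, UmbilicPlanes.landscape, transverse, frame, uM, sgn,
      Fin.sum_univ_two, Fin.rev] <;> ring

/-- [cite: ImbrieJSP2016, eq. (1.1), assumption LLA(ν, C)] SECOND ORDER (the `Ω`-mechanism of
LLA.md P12–P14): `⟨f_{ik}, V (H₀ + N) V f_{jl}⟩ = 2 δ_{ij} δ_{kl} W(j,l)²` with the transition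
amplitude `W(j,l) = ⟨u⁺|V|u⁻⟩ = (p² − q²) d − 2pq (a + J₁σ₁(j) + J₂σ₃(l))`; the `σ₁σ₃`-coefficient
of `W²` is `2(2pq)² J₁J₂ = 2 sin²θ·J₁J₂` (at `N = 1`): the ends couple at second order through the
middle spin with strength `∝ sin²θ·J₁J₂`. -/
theorem second_order (p q a d J₁ J₂ : ℝ) (i j k l : Fin 2) :
    UmbilicPlanes.inner (frame p q i k) (V a d J₁ J₂ (H0N p q (V a d J₁ J₂ (frame p q j l))))
      = if i = j ∧ k = l then
          2 * ((p ^ 2 - q ^ 2) * d - 2 * p * q * (a + J₁ * sgn j + J₂ * sgn l)) ^ 2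
        else 0 := by
  fin_cases i <;> fin_cases j <;> fin_cases k <;> fin_cases l <;>
    norm_num [UmbilicPlanes.inner, V, H0N, diag, UmbilicPlanes.landscape, transverse, frame, uM,
      sgn, Fin.sum_univ_two, Fin.rev] <;> ring

end Literature.MathematicalPhysics.QuantumLattice.Imbrie2016.ChartBF13
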